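import Summits.NavierStokesRegularity.NavierStokesRegularity.Theorems.TypeICertificateLadderRungReynoldsOneOseenGauge
import Literature.Analysis.FluidPDE.NSBoundedMildOseenClassical
import Literature.Analysis.FluidPDE.KNSSSmoothingHolds
import Literature.Analysis.FluidPDE.ClassicalSolutionGlue
import HarnessLib

/-!
# Route TypeICertificateLadder — the Leray rate with constant `1` for MILD solutions in the Oseen
  gauge (C31-M of cell pub-ns-dss, mild rendering: no classical regularity and no pressure are
  posited; helper of crux stmt-NavierStokesRegularity-2882, whose rung `X_1` is the Leray–Hopf
  version)

The companion file `TypeICertificateLadderRungReynoldsOneOseenGauge.lean` proves C31-M for a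
CLASSICAL solution `(u, p)`. Here the regularity and the pressure are removed from the hypotheses:
`u` is only a jointly continuous field on `(0,T) × E` with weakly divergence-free slices, bounded on
every sub-slab `(0,T') × E` (`T' < T`), satisfying the Oseen integral equation
`u(t) = e^{(t−s)Δ}u(s) − B¹_s(u,u)(t)` pointwise between all pairs `0 < s < t < T` — the
Koch–Nadirashvili–Seregin–Šverák class of bounded mild solutions (`L^∞_loc((0,T); L^∞)`, the
continuous representative) — and unbounded on `(0,T) × E`.

* `isMildNSSolutionBetween_of_oseen_bound` — the pointwise Oseen equation between two times for a
  bounded measurable field implies the tree's two-time duality identity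
  (`IsMildNSSolutionBetween 1 0 u s t`; Lemarié-Rieusset 2016 Thm. 6.1, KNSS 2009 Rem. 4.1).
* `isSmoothSpaceTimeOn_of_oseenMild` — such a field is jointly `C^∞` on `(0,T) × E`: on every
  window `(s,T₁)` it IS the canonical representative of KNSS 2009 Prop. 4.1
  (`knss2009_smoothing_holds`).
* `exists_isClassicalNSSolutionOn_translate_of_oseenMild` — for every `s ∈ (0,T)` the translate
  `u(· + s)` is a classical solution on `(0, T − s)` for some smooth pressure
  (Fabes–Jones–Rivière, `classical_of_smooth_isMildNSSolutionOn_holds`).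
* `lerayRate_frequently_gt_of_oseenMild_continuous`, `one_le_limsup_lerayRate_of_oseenMild_continuous`
  — hence (on `ℝ³`) `limsup_{t↑T} √(T−t)‖u(t)‖_∞ ≥ 1`, by the classical rendering
  `lerayRate_frequently_gt_of_oseenMild` applied to `u(· + T/2)`.

HONEST FRAMING: statements about a HYPOTHETICAL singular time of a hypothetical mild solution; no
such solution is asserted to exist; the constant `1` is a perturbative threshold and nothing is said
at or above it; nothing here bears on the regularity question itself.
Lands `--supports stmt-NavierStokesRegularity-2882`.
-/

noncomputable section

namespace Summit.NavierStokesRegularity.NavierStokesRegularity.Theorems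

set_option linter.dupNamespace false

open MeasureTheory Set Filter Topology Function
open scoped RealInnerProductSpace ENNReal ContDiff
open Literature.Analysis Literature.Analysis.FluidPDE

section General

variable {E : Type*} [NormedAddCommGroup E] [InnerProductSpace ℝ E] [FiniteDimensional ℝ E]
  [MeasurableSpace E] [BorelSpace E]

/-! ### From the pointwise Oseen equation to the duality identity -/

/-- **The pointwise Oseen equation implies the two-time duality identity** (Lemarié-Rieusset 2016,
Thm. 6.1, (6.12) ⇒ (6.11); KNSS 2009, Rem. 4.1: mild ⇒ very weak). Let `u` be jointly measurable
and bounded by `M` on `(s,t) × E`, with the slice `u s` measurable and bounded by `M` and the slice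
`u t` continuous, and suppose `u t = e^{(t−s)Δ}u(s) − B¹_s(u,u)(t)` pointwise. Then
`IsMildNSSolutionBetween 1 0 u s t`: testing against a solenoidal `φ`, the caloric term gives
`∫⟪u(s), e^{(t−s)Δ}φ⟫` (`integral_inner_heatExtension_comm_of_bound`) and the Duhamel term gives
`∫ₛᵗ∫⟪u(τ), (u(τ)·∇)e^{(t−τ)Δ}φ⟫` (`integral_inner_oseenDuhamel_eq_neg_intervalIntegral`); the proof
is that of `IsTypeIAncientMild.isMildNSSolutionBetween` with the Type-I bound replaced by `M`.
[cite: LemarieRieusset2016, Thm. 6.1 ((6.12) ⇒ (6.11))] -/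
theorem isMildNSSolutionBetween_of_oseen_bound {u : ℝ → E → E} {s t M : ℝ} (hst : s < t)
    (hM : 0 ≤ M)
    (hmeas : AEStronglyMeasurable (uncurry u)
      ((volume : Measure (ℝ × E)).restrict (Ioo s t ×ˢ univ)))
    (huM : ∀ τ ∈ Ioo s t, ∀ y, ‖u τ y‖ ≤ M)
    (hsm : AEStronglyMeasurable (u s) volume) (hsM : ∀ y, ‖u s y‖ ≤ M)
    (htc : Continuous (u t))
    (hoseen : ∀ x, u t x =
      UnboundedOperators.heatExtension (u s) (t - s) x - oseenDuhamel 1 s u u t x) :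
    IsMildNSSolutionBetween 1 0 u s t := by
  intro φ hφ hdiv
  have hφc : Continuous φ := hφ.contDiff.continuous
  -- the tested Duhamel term and the tested caloric term
  have hB := integral_inner_oseenDuhamel_eq_neg_intervalIntegral one_pos hmeas hM huM hst le_rfl
    hφ hdiv
  have hA := integral_inner_heatExtension_comm_of_bound hsm hsM hφc hφ.hasCompactSupport
    (sub_pos.2 hst)
  -- integrability of the three pairings
  obtain ⟨K, -, hK⟩ := exists_norm_oseenDuhamel_bounded_le (E := E)
  have hiB : Integrable (fun x => ⟪oseenDuhamel 1 s u u t x, φ x⟫) (volume : Measure E) :=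
    integrable_inner_of_norm_le_of_hasCompactSupport
      (aestronglyMeasurable_oseenDuhamel one_pos hmeas hmeas hM huM huM hst le_rfl)
      (fun x => hK one_pos hst hM huM huM x) hφc hφ.hasCompactSupport
  have hiU : Integrable (fun x => ⟪u t x, φ x⟫) (volume : Measure E) :=
    integrable_inner_of_continuous_of_hasCompactSupport htc hφc hφ.hasCompactSupport
  have hiA : Integrable
      (fun x => ⟪UnboundedOperators.heatExtension (u s) (t - s) x, φ x⟫) (volume : Measure E) := by
    refine (hiU.add hiB).congr (Eventually.of_forall fun x => ?_)
    simp only [Pi.add_apply, hoseen x, inner_sub_left, sub_add_cancel]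
  -- assemble
  calc ∫ x, ⟪u t x, φ x⟫
      = ∫ x, (⟪UnboundedOperators.heatExtension (u s) (t - s) x, φ x⟫ -
          ⟪oseenDuhamel 1 s u u t x, φ x⟫) := by
        refine integral_congr_ae (Eventually.of_forall fun x => ?_)
        simp only [hoseen x, inner_sub_left]
    _ = (∫ x, ⟪UnboundedOperators.heatExtension (u s) (t - s) x, φ x⟫) -
          ∫ x, ⟪oseenDuhamel 1 s u u t x, φ x⟫ := integral_sub hiA hiB
    _ = (∫ x, ⟪u s x, heatTest 1 φ (t - s) x⟫) +
          (∫ τ in s..t, ∫ x, ⟪u τ x, convect (u τ) (heatTest 1 φ (t - τ)) x⟫) +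
          ∫ τ in s..t, ∫ x, ⟪(0 : ℝ → E → E) τ x, heatTest 1 φ (t - τ) x⟫ := by
        rw [hA, hB, heatTest_of_pos one_pos (sub_pos.2 hst), one_mul]
        simp

/-! ### Joint smoothness: the field is the canonical KNSS representative on every window -/

/-- **Slab-bounded continuous Oseen-mild fields are jointly smooth** (KNSS 2009, Prop. 4.1: the
canonical representative `e^{(t−s)Δ}u(s) − B¹_s(u,u)(t)` of a bounded mild solution is jointly
`C^∞` on `(s,T₁) × E` — the tree's proved fact `knss2009_smoothing_holds`). If `u` is jointly
continuous on `(0,T) × E`, bounded on every `(0,T') × E` (`T' < T`), and satisfies the Oseen equation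
pointwise between all pairs of times of `(0,T)`, then `u` coincides with that representative on
every window `(s,T₁)`, `0 < s < T₁ < T`, hence is jointly `C^∞` on `(0,T) × E` (smoothness is
local). [cite: KochNadirashviliSereginSverak2009, Prop. 4.1 (arXiv:0709.3599 p. 8)] -/
theorem isSmoothSpaceTimeOn_of_oseenMild {u : ℝ → E → E} {T : ℝ}
    (hcont : ContinuousOn (uncurry u) (Ioo 0 T ×ˢ univ))
    (hbdd : ∀ T' < T, ∃ M : ℝ, ∀ t ∈ Ioo 0 T', ∀ x, ‖u t x‖ ≤ M)
    (hoseen : ∀ s t : ℝ, 0 < s → s < t → t < T → ∀ X,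
      u t X = UnboundedOperators.heatExtension (u s) (t - s) X - oseenDuhamel 1 s u u t X) :
    IsSmoothSpaceTimeOn (Ioo 0 T) u := by
  refine contDiffOn_of_locally_contDiffOn fun q hq => ?_
  obtain ⟨ht, -⟩ := mem_prod.1 hq
  -- the window `(s, T₁) = (t/2, (t+T)/2)` around the time `t = q.1`
  set s : ℝ := q.1 / 2 with hsdef
  set T₁ : ℝ := (q.1 + T) / 2 with hT₁def
  have hs0 : 0 < s := by rw [hsdef]; linarith [ht.1]
  have hst : s < q.1 := by rw [hsdef]; linarith [ht.1]
  have htT₁ : q.1 < T₁ := by rw [hT₁def]; linarith [ht.2]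
  have hT₁T : T₁ < T := by rw [hT₁def]; linarith [ht.2]
  have hsT₁ : s < T₁ := hst.trans htT₁
  refine ⟨Ioo s T₁ ×ˢ univ, isOpen_Ioo.prod isOpen_univ, ⟨⟨hst, htT₁⟩, mem_univ _⟩, ?_⟩
  refine ContDiffOn.mono ?_ inter_subset_right
  -- the slab bound on `(0, T₁)`
  obtain ⟨M₀, hM₀⟩ := hbdd T₁ hT₁T
  set M : ℝ := max M₀ 0 with hMdef
  have hM : 0 ≤ M := le_max_right _ _
  have huM : ∀ τ ∈ Ioo 0 T₁, ∀ y, ‖u τ y‖ ≤ M := fun τ hτ y =>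
    (hM₀ τ hτ y).trans (le_max_left _ _)
  -- slices are continuous, the datum `u s` is bounded measurable
  have hslice : ∀ τ ∈ Ioo 0 T, Continuous (u τ) := fun τ hτ =>
    hcont.comp_continuous (Continuous.prodMk_right τ) fun x => ⟨hτ, mem_univ x⟩
  have hsm : AEStronglyMeasurable (u s) volume :=
    (hslice s ⟨hs0, hsT₁.trans hT₁T⟩).aestronglyMeasurable
  have hsM : eLpNorm (u s) ∞ volume ≤ ENNReal.ofReal M :=
    eLpNorm_top_le_ofReal_of_norm_le (huM s ⟨hs0, hsT₁⟩)
  have hsub : Ioo s T₁ ×ˢ (univ : Set E) ⊆ Ioo 0 T ×ˢ univ :=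
    prod_mono (Ioo_subset_Ioo hs0.le hT₁T.le) subset_rfl
  have hum : AEStronglyMeasurable (uncurry u)
      ((volume : Measure (ℝ × E)).restrict (Ioo s T₁ ×ˢ univ)) :=
    (hcont.mono hsub).aestronglyMeasurable (measurableSet_Ioo.prod MeasurableSet.univ)
  have huM' : ∀ τ ∈ Ioo s T₁, eLpNorm (u τ) ∞ volume ≤ ENNReal.ofReal M := fun τ hτ =>
    eLpNorm_top_le_ofReal_of_norm_le (huM τ ⟨hs0.trans hτ.1, hτ.2⟩)
  have husol : ∀ τ ∈ Ioo s T₁, u τ =ᵐ[volume] fun x =>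
      UnboundedOperators.heatExtension (u s) (1 * (τ - s)) x - oseenDuhamel 1 s u u τ x :=
    fun τ hτ => Eventually.of_forall fun x => by
      rw [one_mul]; exact hoseen s τ hs0 hτ.1 (hτ.2.trans hT₁T) x
  -- KNSS Prop. 4.1: the canonical representative is jointly smooth, and it is `u` itself
  obtain ⟨hsmooth, -, -⟩ := knss2009_smoothing_holds E one_pos hsT₁ hM hsm hsM hum huM' husol
  refine (hsmooth : ContDiffOn ℝ ∞ _ _).congr fun z hz => ?_
  obtain ⟨hz1, -⟩ := mem_prod.1 hz
  show u z.1 z.2 = UnboundedOperators.heatExtension (u s) (1 * (z.1 - s)) z.2 -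
    oseenDuhamel 1 s u u z.1 z.2
  rw [one_mul]
  exact hoseen s z.1 hs0 hz1.1 (hz1.2.trans hT₁T) z.2

/-! ### The pressure: translates are classical -/

/-- **Slab-bounded continuous Oseen-mild fields with weakly divergence-free slices are classical
after every time `s ∈ (0,T)`** (Fabes–Jones–Rivière 1972, Thm. 2.1, the tree's proved fact
`classical_of_smooth_isMildNSSolutionOn_holds`: smooth + bounded + mild in duality form ⇒ classical
for some smooth pressure). The translate `v = u(· + s)` is a duality-form mild solution on
`(0, T − s)` from the bounded datum `u(s)` (`isMildNSSolutionBetween_of_oseen_bound` +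
`IsMildNSSolutionBetween.comp_add_right_zero`), jointly smooth (`isSmoothSpaceTimeOn_of_oseenMild`)
and bounded on sub-slabs; hence `(v, q)` is a classical solution of unforced Navier–Stokes
(`ν = 1`) on `(0, T − s)` for some smooth `q`. [cite: FabesJonesRiviere1972, Thm. 2.1] -/
theorem exists_isClassicalNSSolutionOn_translate_of_oseenMild {u : ℝ → E → E} {T : ℝ}
    (hcont : ContinuousOn (uncurry u) (Ioo 0 T ×ˢ univ))
    (hdiv : ∀ t ∈ Ioo 0 T, IsWeaklyDivFree (u t))
    (hbdd : ∀ T' < T, ∃ M : ℝ, ∀ t ∈ Ioo 0 T', ∀ x, ‖u t x‖ ≤ M)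
    (hoseen : ∀ s t : ℝ, 0 < s → s < t → t < T → ∀ X,
      u t X = UnboundedOperators.heatExtension (u s) (t - s) X - oseenDuhamel 1 s u u t X)
    {s : ℝ} (hs0 : 0 < s) (hsT : s < T) :
    ∃ q : ℝ → E → ℝ, IsClassicalNSSolutionOn (Ioo 0 (T - s)) 1 0 (fun t => u (t + s)) q := by
  have hTs : 0 < T - s := sub_pos.2 hsT
  set v : ℝ → E → E := fun t => u (t + s) with hv
  have hslice : ∀ τ ∈ Ioo 0 T, Continuous (u τ) := fun τ hτ =>
    hcont.comp_continuous (Continuous.prodMk_right τ) fun x => ⟨hτ, mem_univ x⟩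
  -- the duality identity between all pairs `s ≤ a < b < T`
  have hbetween : ∀ a b : ℝ, s ≤ a → a < b → b < T → IsMildNSSolutionBetween 1 0 u a b := by
    intro a b hsa hab hbT
    have ha0 : 0 < a := hs0.trans_le hsa
    obtain ⟨M₀, hM₀⟩ := hbdd ((b + T) / 2) (by linarith)
    set M : ℝ := max M₀ 0 with hMdef
    have hM : 0 ≤ M := le_max_right _ _
    have hbT' : b < (b + T) / 2 := by linarith
    have huM : ∀ τ ∈ Ioo a b, ∀ y, ‖u τ y‖ ≤ M := fun τ hτ y =>
      (hM₀ τ ⟨ha0.trans hτ.1, hτ.2.trans hbT'⟩ y).trans (le_max_left _ _)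
    have hsub : Ioo a b ×ˢ (univ : Set E) ⊆ Ioo 0 T ×ˢ univ :=
      prod_mono (Ioo_subset_Ioo ha0.le hbT.le) subset_rfl
    have hum : AEStronglyMeasurable (uncurry u)
        ((volume : Measure (ℝ × E)).restrict (Ioo a b ×ˢ univ)) :=
      (hcont.mono hsub).aestronglyMeasurable (measurableSet_Ioo.prod MeasurableSet.univ)
    exact isMildNSSolutionBetween_of_oseen_bound hab hM hum huM
      (hslice a ⟨ha0, hab.trans hbT⟩).aestronglyMeasurable
      (fun y => (hM₀ a ⟨ha0, hab.trans hbT'⟩ y).trans (le_max_left _ _))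
      (hslice b ⟨ha0.trans hab, hbT⟩) (hoseen a b ha0 hab hbT)
  -- mild solution in duality form from the datum `u s` on `(0, T − s)`
  have hmild : IsMildNSSolutionOn (Ioo 0 (T - s)) 1 0 (u s) v := by
    refine ⟨fun t ht => hdiv (t + s) ⟨by linarith [ht.1], by linarith [ht.2]⟩, fun t ht => ?_⟩
    have key : IsMildNSSolutionBetween 1 0 v 0 t :=
      (hbetween (0 + s) (t + s) (by rw [zero_add]) (by linarith [ht.1])
        (by linarith [ht.2])).comp_add_right_zero
    simpa [hv] using (isMildNSSolutionFrom_self_iff (u := v)).2 key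
  -- joint smoothness of the translate
  have hsm : IsSmoothSpaceTimeOn (Ioo 0 (T - s)) v := by
    refine ((isSmoothSpaceTimeOn_of_oseenMild hcont hbdd hoseen).comp_add_right s).mono
      fun t ht => ?_
    simp only [mem_preimage, mem_Ioo]
    exact ⟨by linarith [ht.1], by linarith [ht.2]⟩
  -- uniform bound on `(0, T₁)`, `T₁ < T − s`
  have hbddv : ∀ T₁ ∈ Ioo 0 (T - s), ∃ K : ℝ≥0∞, K < ⊤ ∧
      ∀ t ∈ Ioo 0 T₁, eLpNorm (v t) ∞ volume ≤ K := by
    intro T₁ hT₁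
    obtain ⟨M₀, hM₀⟩ := hbdd (T₁ + s) (by linarith [hT₁.2])
    refine ⟨ENNReal.ofReal M₀, ENNReal.ofReal_lt_top, fun t ht => ?_⟩
    exact eLpNorm_top_le_ofReal_of_norm_le
      (hM₀ (t + s) ⟨by linarith [ht.1], by linarith [ht.2]⟩)
  -- the datum: measurable and integrable against Gaussians (bounded)
  obtain ⟨M₁, hM₁⟩ := hbdd ((s + T) / 2) (by linarith)
  have hsmid : s ∈ Ioo 0 ((s + T) / 2) := ⟨hs0, by linarith⟩
  have hu₀m : AEStronglyMeasurable (u s) volume := (hslice s ⟨hs0, hsT⟩).aestronglyMeasurable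
  have hu₀G : ∀ a : ℝ, 0 < a →
      Integrable (fun y => UnboundedOperators.heatKernel a y * ‖u s y‖) volume := by
    intro a ha
    have hK : Integrable (UnboundedOperators.heatKernel (E := E) a) volume :=
      UnboundedOperators.integrable_heatKernel_holds ha
    have h := hK.bdd_mul (c := M₁) hu₀m.norm
      (Eventually.of_forall fun y => by rw [norm_norm]; exact hM₁ s hsmid y)
    refine h.congr (Eventually.of_forall fun y => ?_)
    simp only [mul_comm]
  exact classical_of_smooth_isMildNSSolutionOn_holds E one_pos hTs hu₀m hu₀G hsm hbddv hmild

end General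

/-! ### C31-M for mild solutions: the Leray rate with constant `1` -/

/-- **Leray rate with constant one in the Oseen gauge for MILD solutions (C31-M).** Let `u` be
jointly continuous on `(0,T) × ℝ³` (`T > 0`) with weakly divergence-free slices, bounded on every
`(0,T') × ℝ³` (`T' < T`), satisfying the Oseen integral equation
`u(t) = e^{(t−s)Δ}u(s) − B¹_s(u,u)(t)` pointwise between all pairs of times of `(0,T)` (KNSS gauge,
unit viscosity), and unbounded on `(0,T) × ℝ³`. Then for every `θ < 1`:
`θ < √(T−t)‖u(t,x)‖` for some `x`, frequently as `t ↑ T` — i.e.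
`limsup_{t↑T} √(T−t)‖u(t)‖_∞ ≥ 1`. NO classical regularity, NO pressure, NO energy inequality,
NO decay of the data, NO Leray–Hopf structure are assumed. Proof: the translate `u(· + T/2)` is a
classical solution on `(0, T/2)` for some pressure
(`exists_isClassicalNSSolutionOn_translate_of_oseenMild`), slab-bounded, Oseen-mild between all
pairs (`oseenDuhamel_translate`) and unbounded, so the classical rendering
`lerayRate_frequently_gt_of_oseenMild` applies; `𝓝[<] T` is the image of `𝓝[<] (T/2)` under
`t ↦ t + T/2`. Nothing is claimed at or above the threshold.
[this file; KNSS 2009 Prop. 4.1, §6 + Fabes–Jones–Rivière + pub-ns-dss T31⁗] -/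
theorem lerayRate_frequently_gt_of_oseenMild_continuous {T : ℝ} (hT : 0 < T)
    {u : ℝ → EuclideanSpace ℝ (Fin 3) → EuclideanSpace ℝ (Fin 3)}
    (hcont : ContinuousOn (uncurry u) (Ioo 0 T ×ˢ univ))
    (hdiv : ∀ t ∈ Ioo 0 T, IsWeaklyDivFree (u t))
    (hbdd : ∀ T' < T, ∃ M : ℝ, ∀ t ∈ Ioo 0 T', ∀ x, ‖u t x‖ ≤ M)
    (hoseen : ∀ s t : ℝ, 0 < s → s < t → t < T → ∀ X,
      u t X = UnboundedOperators.heatExtension (u s) (t - s) X - oseenDuhamel 1 s u u t X)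
    (hunb : ∀ M : ℝ, ∃ t ∈ Ioo 0 T, ∃ x, M < ‖u t x‖) {θ : ℝ} (hθ : θ < 1) :
    ∃ᶠ t in 𝓝[<] T, ∃ x, θ < Real.sqrt (T - t) * ‖u t x‖ := by
  -- translate by `s = T/2`
  set s : ℝ := T / 2 with hsdef
  have hs0 : 0 < s := by rw [hsdef]; linarith
  have hsT : s < T := by rw [hsdef]; linarith
  have hTs : 0 < T - s := sub_pos.2 hsT
  set v : ℝ → EuclideanSpace ℝ (Fin 3) → EuclideanSpace ℝ (Fin 3) := fun t => u (t + s) with hv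
  obtain ⟨q, hcl⟩ := exists_isClassicalNSSolutionOn_translate_of_oseenMild hcont hdiv hbdd hoseen hs0 hsT
  have hbddv : ∀ T' < T - s, ∃ M : ℝ, ∀ t ∈ Ioo 0 T', ∀ x, ‖v t x‖ ≤ M := by
    intro T' hT'
    obtain ⟨M, hM⟩ := hbdd (T' + s) (by linarith)
    exact ⟨M, fun t ht x => hM (t + s) ⟨by linarith [ht.1], by linarith [ht.2]⟩ x⟩
  have hoseenv : ∀ a b : ℝ, 0 < a → a < b → b < T - s → ∀ X,
      v b X = UnboundedOperators.heatExtension (v a) (b - a) X - oseenDuhamel 1 a v v b X := by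
    intro a b ha hab hb X
    have key := hoseen (a + s) (b + s) (by linarith) (by linarith) (by linarith) X
    rw [hv, oseenDuhamel_translate 1 a s u u b X, show b - a = b + s - (a + s) by ring]
    exact key
  have hunbv : ∀ M : ℝ, ∃ t ∈ Ioo 0 (T - s), ∃ x, M < ‖v t x‖ := by
    intro M
    obtain ⟨M₁, hM₁⟩ := hbdd ((s + T) / 2) (by linarith)
    obtain ⟨t, ht, x, hx⟩ := hunb (max M M₁)
    have hts : (s + T) / 2 ≤ t := by
      by_contra hlt
      exact absurd (hM₁ t ⟨ht.1, not_le.1 hlt⟩ x) (not_le.2 ((le_max_right _ _).trans_lt hx))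
    refine ⟨t - s, ⟨by linarith, by linarith [ht.2]⟩, x, ?_⟩
    rw [hv]
    simp only [sub_add_cancel]
    exact (le_max_left _ _).trans_lt hx
  -- the classical rendering at the translated singular time `T − s`
  have h1 := lerayRate_frequently_gt_of_oseenMild hTs hcl hbddv hoseenv hunbv hθ
  -- transport along `t ↦ t + s`: `𝓝[<](T − s) → 𝓝[<] T`
  have htend : Tendsto (fun t : ℝ => t + s) (𝓝[<] (T - s)) (𝓝[<] T) := by
    have hc : ContinuousWithinAt (fun t : ℝ => t + s) (Iio (T - s)) (T - s) :=
      (continuous_add_const s).continuousWithinAt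
    have h := hc.tendsto_nhdsWithin (fun t ht => by
      show t + s ∈ Iio T
      rw [mem_Iio] at ht ⊢; linarith)
    rwa [sub_add_cancel] at h
  refine htend.frequently_map (fun t : ℝ => t + s) (fun t ht => ?_) h1
  obtain ⟨x, hx⟩ := ht
  refine ⟨x, ?_⟩
  rw [show T - (t + s) = T - s - t by ring]
  exact hx

/-- **C31-M for mild solutions, `limsup` form: `limsup_{t ↑ T} √(T − t)‖u(t)‖_∞ ≥ 1`** under the
hypotheses of `lerayRate_frequently_gt_of_oseenMild_continuous` (the spatial supremum taken in
`ℝ≥0∞`, so that no boundedness of the slices near `T` is presupposed). [this file] -/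
theorem one_le_limsup_lerayRate_of_oseenMild_continuous {T : ℝ} (hT : 0 < T)
    {u : ℝ → EuclideanSpace ℝ (Fin 3) → EuclideanSpace ℝ (Fin 3)}
    (hcont : ContinuousOn (uncurry u) (Ioo 0 T ×ˢ univ))
    (hdiv : ∀ t ∈ Ioo 0 T, IsWeaklyDivFree (u t))
    (hbdd : ∀ T' < T, ∃ M : ℝ, ∀ t ∈ Ioo 0 T', ∀ x, ‖u t x‖ ≤ M)
    (hoseen : ∀ s t : ℝ, 0 < s → s < t → t < T → ∀ X,
      u t X = UnboundedOperators.heatExtension (u s) (t - s) X - oseenDuhamel 1 s u u t X)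
    (hunb : ∀ M : ℝ, ∃ t ∈ Ioo 0 T, ∃ x, M < ‖u t x‖) :
    1 ≤ Filter.limsup (fun t => ⨆ x, ENNReal.ofReal (Real.sqrt (T - t) * ‖u t x‖)) (𝓝[<] T) := by
  refine le_of_forall_lt_imp_le_of_dense fun a ha => ?_
  have ha' : a ≠ ⊤ := ne_top_of_lt ha
  have hθ : a.toReal < 1 := by
    have := (ENNReal.toReal_lt_toReal ha' ENNReal.one_ne_top).2 ha
    simpa using this
  have hfr := lerayRate_frequently_gt_of_oseenMild_continuous hT hcont hdiv hbdd hoseen hunb hθ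
  refine Filter.le_limsup_of_frequently_le (hfr.mono ?_)
  rintro t ⟨x, hx⟩
  refine le_iSup_of_le x ?_
  rw [← ENNReal.ofReal_toReal ha']
  exact ENNReal.ofReal_le_ofReal hx.le

end Summit.NavierStokesRegularity.NavierStokesRegularity.Theorems

end
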